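import Literature.IUT.HodgeArakelov.LabelClassesOfCuspsCor24iLevelsAssembly
import Literature.IUT.HodgeTheaters.TemperedCoveringsCor23LevelsGraph
import Literature.IUT.HodgeTheaters.TemperedCoveringsCor23LevelsDatum
import HarnessLib

/-!
# [IUTchII] Cor 2.4 (i), input (B): the assembly with Cor 2.3 (vi) BY NAME and the B4 core DISCHARGED

S. Mochizuki, *Inter-universal Teichmüller Theory II*, kurims manuscript (Dec. 2020), §2, Cor 2.4 (i), proof p.70 l.−2 –
p.71 l.3 ("by applying the equivalence of [IUTchI], Corollary 2.3, (vi) [cf. also [CombGC], Proposition 1.2, (ii)], to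
the various finite index open subgroups of `Δ^±_v`, it follows that `γ' ∈ Δ̂^±_{v□}`"); *… I*, kurims manuscript (May
2020), §2, Cor 2.3 (vi) p.48 [cite: Mochizuki2012, II Cor 2.4 (i) pp.70-71] (D-0012 claim key, status disputed;
PROOF-ONLY — no definition, nothing of the series asserted; abc-iut cell, seat abc-iut-w5-d121; node
`IUTchII:Cor2.4(i)` input (B) = GAP-LEDGER G-w4d012-2; sub-DAG `plan/L5/SUBDAG-IUTchI-Cor23Levels.md`, row B5).

WHAT IT ADDS to `LabelClassesOfCuspsCor24iLevelsAssembly` (p419450).  There the (B) binder `h23vi` is supplied from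
abc-iut-L5-t11's carrier `Prop24Tower.SubgraphLevelData` with its per-level inputs as NAMED PREDICATES, among them
B3 `LevelIncidence` and the block property `IsBlock`.  Two of those have meanwhile been reduced further in the tree:
* abc-iut-w4-d076's `Prop24Tower.CoveringLevelGraphs` (`TemperedCoveringsCor23LevelsGraph`, p418580) REALISES the level
  data by coverings of semi-graphs with deck transformations (`toLevelData`) and PROVES the B4 core there
  (`toLevelData_isBlock`: components of `p_i⁻¹(ℍ)` are blocks — [SemiAnbd] §1 combinatorics, no hypothesis);
* abc-iut-L5-t11's `SubgraphLevelData.LevelDatum` (`TemperedCoveringsCor23LevelsDatum`, p418798) records the [IUTchI] §2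
  datum of the covering `X_{J_i}` with its agreement atoms, and `levelIncidence_of_cor23vi` derives B3 from
  abc-iut-L5-t1's predicate `Cor23vi` FOR THE LEVEL DATA — Cor 2.3 (vi) BY NAME, as print applies it.
This file composes them: `StableCurveAgreement.h23vi_of_coveringLevelGraphs` and the capstones
`cor24_i'_of_levels_byName` / `cor24_ii_iii'_of_levels_byName` close the decls of record `Cor24_i'` / `Cor24_ii_iii'`
with input (B) resting on: the level data `Cor23vi` BY NAME, the dictionary row B1 (c) `StabLeDeltaHLevel`
(`Stab_{Δ^tp_X}(ℍ̃_i) ⊆ Δ^tp_{X,ℍ}·J_i`, abc-iut-L3 row D3b), `LevelsNormal`, the levels' shrinking and placement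
(`hbasis'`, `hlevV`, `hinf`) — and nothing anonymous.  PROVED (composition only); every [IUTchI]/[IUTchII] statement is
a HYPOTHESIS; typed ≠ proved; nothing here bears on [IUTchIII] Cor 3.12.
-/

universe u

namespace Literature.IUT.HodgeArakelov

open Literature.IUT.HodgeTheaters Topology
open Literature.AnabelianGeometry.SemiGraphs (IsProSigma)
open scoped Pointwise

namespace PlusMinusTower

namespace StableCurveAgreement

variable {S : BadPlaceSetting.{u}} {P : TopGroup.{u}} {T : TemperedCoverings S P}
  {W : PlusMinusTower T} {C : CuspidalInertiaData W} {D : StableCurveTemperedData.{u}}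

/-- **IUTchII:Cor2.4(i)** (kurims p.70 l.−2 – p.71 l.3) **The open-subgroup step (B) with [IUTchI] Cor 2.3 (vi) BY NAME
at every level and the B4 core discharged.**  HYPOTHESES (named, none asserted): the B13 agreement `A` with the
`Δ`-level `ℍ`-dictionary `Dic` of the target `Π_{v□}`; a tower of levels `Ĵ_i ⊆ Π̂_{X_v}` realised by coverings of
semi-graphs (abc-iut-w4-d076's `CoveringLevelGraphs`); at each level the [IUTchI] §2 datum of `X_{J_i}` with its
agreement atoms (abc-iut-L5-t11's `LevelDatum`) SATISFYING abc-iut-L5-t1's `Cor23vi`; the dictionary row B1 (c)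
`StabLeDeltaHLevel`; `LevelsNormal`; the levels shrink to `1` (`hbasis'`) and lie below `Π̂_v` (`hlevV`), `Π^±_v ∩ Π̂_v ⊆ Π_v`
(`hinf`); Def 2.3 (ii)′ (`hrel'`); and the printed hypotheses on `I_t` (`hI`, `hIΔ`).  CONCLUSION: the (B) binder of
`cor24_i_of_inputs_inc`.  PROVED (`h23vi_of_subgraphLevelData` ∘ `levelIncidence_of_cor23vi` ∘ `toLevelData_isBlock`).
[claim: Mochizuki2012, status: disputed] -/
theorem h23vi_of_coveringLevelGraphs (A : StableCurveAgreement W C D) {H : Subgroup P}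
    (Dic : A.SubgraphDictionary H) (Tw : D.Prop24Tower) (Cv : Tw.CoveringLevelGraphs)
    (Ad : ∀ i, Cv.toLevelData.LevelDatum i) (h23vi : ∀ i, (Ad i).lev.Cor23vi) (hN : Tw.LevelsNormal)
    (hstab : Cv.toLevelData.StabLeDeltaHLevel)
    (hbasis' : ∀ O ∈ 𝓝 (1 : D.PiHat), ∃ i, ((Tw.Jhat i : Subgroup D.PiHat) : Set D.PiHat) ⊆ O)
    (hlevV : ∀ i, Tw.Jhat i ≤ (W.hat.subgroupOf W.pmHat).map A.eHat.toMonoidHom)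
    (hinf : W.piPM ⊓ W.hat ≤ W.piV) (hrel' : Def23_ii' C W.piV W.piPM) {I : Subgroup W.Corhat}
    (hI : C.IsCuspidalInertia W.piV I) (hIΔ : I ≤ W.deltaBox H) :
    ∀ γ' : W.Corhat, γ' ∈ W.piPM ⊓ W.aug.ker →
      I.map (MulAut.conj γ').toMonoidHom ≤ W.pmBox H → γ' ∈ closure (W.deltaPmBox H : Set W.Corhat) :=
  A.h23vi_of_subgraphLevelData Dic Tw Cv.toLevelData hN (Cv.toLevelData.levelIncidence_of_cor23vi Ad h23vi)
    Cv.toLevelData_isBlock hstab hbasis' hlevV hinf hrel' hI hIΔ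

/-- **IUTchII:Cor2.4(i)** (kurims pp.70–71) The same with the levels' shrinking from the Prop 2.4 sub-nodes
(`DeltaHatClosed`, `LevelsInDelta`, `LevelsCofinal`; `Π̂_{X_v}` profinite). PROVED. [claim: Mochizuki2012, status: disputed] -/
theorem h23vi_of_coveringLevelGraphs' [T2Space D.PiHat] [TotallyDisconnectedSpace D.PiHat]
    (A : StableCurveAgreement W C D) {H : Subgroup P}
    (Dic : A.SubgraphDictionary H) (Tw : D.Prop24Tower) (Cv : Tw.CoveringLevelGraphs)
    (Ad : ∀ i, Cv.toLevelData.LevelDatum i) (h23vi : ∀ i, (Ad i).lev.Cor23vi) (hN : Tw.LevelsNormal)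
    (hstab : Cv.toLevelData.StabLeDeltaHLevel)
    (hΔc : D.DeltaHatClosed) (hΔ : Tw.LevelsInDelta) (hcof : Tw.LevelsCofinal)
    (hlevV : ∀ i, Tw.Jhat i ≤ (W.hat.subgroupOf W.pmHat).map A.eHat.toMonoidHom)
    (hinf : W.piPM ⊓ W.hat ≤ W.piV) (hrel' : Def23_ii' C W.piV W.piPM) {I : Subgroup W.Corhat}
    (hI : C.IsCuspidalInertia W.piV I) (hIΔ : I ≤ W.deltaBox H) :
    ∀ γ' : W.Corhat, γ' ∈ W.piPM ⊓ W.aug.ker →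
      I.map (MulAut.conj γ').toMonoidHom ≤ W.pmBox H → γ' ∈ closure (W.deltaPmBox H : Set W.Corhat) :=
  A.h23vi_of_coveringLevelGraphs Dic Tw Cv Ad h23vi hN hstab (Tw.exists_level_subset_of_mem_nhds hΔc hΔ hcof)
    hlevV hinf hrel' hI hIΔ

end StableCurveAgreement

end PlusMinusTower

/-! ## The decls of record, input (B) resting on Cor 2.3 (vi) BY NAME per admissible `Π_{v□}` -/

section AssemblyByName

open Literature.IUT.HodgeTheaters Topology
open Literature.AnabelianGeometry.SemiGraphs (IsProSigma)

variable {S : BadPlaceSetting.{u}} {P : TopGroup.{u}} {T : TemperedCoverings S P}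
  {D : EtaleThetaData S.toThetaSetting P} {Dsc : StableCurveTemperedData.{u}}
  (Dec : SubgraphDecomposition S T D) (W : PlusMinusTower T) (C : CuspidalInertiaData W)
  {L : LabCuspStructure C} (Ld : LabelledDecomposition Dec L) (I : Subgroup W.Corhat)

/-- **IUTchII:Cor2.4(i)′ — B5 ASSEMBLY, Cor 2.3 (vi) BY NAME** (kurims pp.69–71): the decl of record
`Cor24_i' Dec W C Ld I` from the agreement `A` with [IUTchI] Prop 2.4 (i), [IUTchII] Def 2.3 (ii)′, `e : I_x ≃ₜ* Ẑ`,
`Π^±_v ∩ Π̂_v ⊆ Π_v`, and, per admissible `Π_{v□}` (`LevelsByName`): an [IUTchI] §2 datum `D'` with agreement `A'` and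
`Δ`-dictionary, Cor 2.3 (ii), (v) for `D'`, a tower realised by coverings of semi-graphs with the level data of every
`X_{J_i}` satisfying Cor 2.3 (vi) (`Cor23vi`) — BY NAME —, the dictionary row `StabLeDeltaHLevel`, `LevelsNormal`, the
levels shrinking to `1` and lying below `Π̂_v`.  ALL HYPOTHESES.  PROVED. [claim: Mochizuki2012, status: disputed] -/
theorem cor24_i'_of_levels_byName (A : W.StableCurveAgreement C Dsc) (h24i : Dsc.Prop24i)
    (hrel' : Def23_ii' C W.piV W.piPM) (e : ∀ x : Dsc.Cusp, ↥(Dsc.inertiaTp x) ≃ₜ* HodgeTheaters.ZHat)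
    (hinf : W.piPM ⊓ W.hat ≤ W.piV)
    (LevelsByName : ∀ H : Subgroup P, Cor24_family Dec Ld H →
      ∃ (D' : StableCurveTemperedData.{u}) (A' : W.StableCurveAgreement C D') (_ : A'.SubgraphDictionary H)
        (_ : D'.Cor23ii) (_ : D'.Cor23v) (Tw : D'.Prop24Tower) (Cv : Tw.CoveringLevelGraphs)
        (Ad : ∀ i, Cv.toLevelData.LevelDatum i),
        (∀ i, (Ad i).lev.Cor23vi) ∧ Tw.LevelsNormal ∧ Cv.toLevelData.StabLeDeltaHLevel ∧
        (∀ O ∈ 𝓝 (1 : D'.PiHat), ∃ i, ((Tw.Jhat i : Subgroup D'.PiHat) : Set D'.PiHat) ⊆ O) ∧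
        (∀ i, Tw.Jhat i ≤ (W.hat.subgroupOf W.pmHat).map A'.eHat.toMonoidHom)) :
    Literature.IUT.HodgeArakelov.Cor24_i' Dec W C Ld I :=
  cor24_i'_of_agreements_of_equiv_zHat_inc Dec W C Ld I A h24i hrel' e
    (fun H hH => by
      obtain ⟨D', A', hDic, h23ii, h23vD, -⟩ := LevelsByName H hH
      exact ⟨D', A', hDic, h23ii, h23vD⟩)
    (fun H hH hI hIΔ => by
      obtain ⟨D', A', hDic, -, -, Tw, Cv, Ad, h23vi, hN, hstab, hbasis', hlevV⟩ := LevelsByName H hH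
      exact A'.h23vi_of_coveringLevelGraphs hDic Tw Cv Ad h23vi hN hstab hbasis' hlevV hinf hrel' hI hIΔ)

/-- **IUTchII:Cor2.4(ii)(iii)′ — B5 ASSEMBLY, Cor 2.3 (vi) BY NAME** (kurims p.70): the decl of record
`Cor24_ii_iii' W C H` for an admissible `Π_{v□}`, input (B) supplied per `□'` as in `cor24_i'_of_levels_byName`; the other
inputs as in `cor24_ii_iii'_of_levels_of_equiv_zHat` (`Prop24i`, `Cor23Hyp`, `Cor23iii`, `hBox`, `Def23_ii'`, `e`,
`hinf`, `hcap`, `hYdd`) — ALL HYPOTHESES.  PROVED. [claim: Mochizuki2012, status: disputed] -/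
theorem cor24_ii_iii'_of_levels_byName {H : Subgroup P} (hH : Cor24_family Dec Ld H)
    (A : W.StableCurveAgreement C Dsc) (h24i : Dsc.Prop24i) (hHyp : Dsc.Cor23Hyp) (h23iii : Dsc.Cor23iii)
    (hrel' : Def23_ii' C W.piV W.piPM) (e : ∀ x : Dsc.Cusp, ↥(Dsc.inertiaTp x) ≃ₜ* HodgeTheaters.ZHat)
    (hinf : W.piPM ⊓ W.hat ≤ W.piV)
    (LevelsByName : ∀ H' : Subgroup P, Cor24_family Dec Ld H' →
      ∃ (D' : StableCurveTemperedData.{u}) (A' : W.StableCurveAgreement C D') (_ : A'.SubgraphDictionary H')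
        (_ : D'.Cor23ii) (_ : D'.Cor23v) (Tw : D'.Prop24Tower) (Cv : Tw.CoveringLevelGraphs)
        (Ad : ∀ i, Cv.toLevelData.LevelDatum i),
        (∀ i, (Ad i).lev.Cor23vi) ∧ Tw.LevelsNormal ∧ Cv.toLevelData.StabLeDeltaHLevel ∧
        (∀ O ∈ 𝓝 (1 : D'.PiHat), ∃ i, ((Tw.Jhat i : Subgroup D'.PiHat) : Set D'.PiHat) ⊆ O) ∧
        (∀ i, Tw.Jhat i ≤ (W.hat.subgroupOf W.pmHat).map A'.eHat.toMonoidHom))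
    (hBox : ((W.pmBox H).subgroupOf W.pmHat).map A.eHat.toMonoidHom = Dsc.piTpXH.map Dsc.ιX)
    (hcap : W.pmBox H ⊓ W.piV ≤ W.box H)
    (hYdd : ∀ I : Subgroup W.Corhat, C.IsCuspidalInertia W.piV I → I ≤ W.deltaBox H →
      W.cuspDecomp I 1 ≤ (T.YddL).map (W.emb.comp T.incl)) :
    Literature.IUT.HodgeArakelov.Cor24_ii_iii' W C H :=
  cor24_ii_iii'_of_inputs
    (fun I _ _ => cor24_i'_of_levels_byName Dec W C Ld I A h24i hrel' e hinf LevelsByName H hH)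
    (A.boxOntoGalois_of_cor23iii hBox hHyp h23iii) hcap hYdd

end AssemblyByName

end Literature.IUT.HodgeArakelov
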